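import Summits.BirchSwinnertonDyer.BirchSwinnertonDyer.Theorems.SignedLowerHalvesSmallImageLowerHalfBothSignsRttD2TwistThresholds
import Literature.NumberTheory.GaloisRepresentations.PotentialDiagonalizabilityCriteriaProofs
import HarnessLib

/-!
# Route `SignedLowerHalves`, crux L `SmallImageLowerHalfBothSigns` (stmt-BirchSwinnertonDyer-23599), line `rtt_w3` v14 — E2, row «D-tw-coh» part 2c(vi):
# the twist parameters are PRINCIPAL UNITS — `‖θ(γ)θ'(γ)⁻¹ − 1‖ < 1` whenever `θ' = θ` on `Gal(K̄/K̃_∞)`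

INPUTS hand `bsd-inputs-honda-p1` g23 (LEAD g11 RULING «U»; the hypotheses `h₁ h₂ : ‖u_i − 1‖ < 1` of the LEAD's `exists_twistRingEquiv` (p789673) /
`exists_twistSkeleton` (p790035), `u_i = θ(γ_i)θ'(γ_i)⁻¹`). Since `η = θ/θ'` is a continuous character of the pro-`p` group `Gal(K̃_∞/K)`, its values are
principal units of `𝒪 = 𝒪_{ℚ_p(S)}`:
* `norm_sub_one_lt_of_norm_pow_sub_one_lt` — for `v ∈ 𝒪`, `‖v^{pⁿ} − 1‖ < 1 ⟹ ‖v − 1‖ < 1` (`(v−1)^{pⁿ} = v^{pⁿ} − 1 − p(v−1)r`, ultrametric; `‖p‖ < 1` is the tree's `norm_natCast_padicAlgCl_lt_one`);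
* ★★ `norm_twistUnit_sub_one_lt` — `‖θ(γ)θ'(γ)⁻¹ − 1‖ < 1` for every `γ ∈ Γ_K` when `θ' = θ` on `pairKer κ₁ κ₂`: `γ^{p^m} ∈ Gal(K̄/K̃_m)` and the thresholds
  of part 2c(iii) (`exists_thresholds` at `k = 1`).
THEOREMS only; no `def`, no named fact, no `sorry`; crux L, crux M, E2 and BSD remain OPEN and are proved for NO curve by any of this.
References: [SerreLocalFields1979] XIV §4 (principal units, pro-`p` images); [JohnsonLeungKings2011] §4.1; [Rubin2000] Ch. VI §6.1.
-/

set_option autoImplicit false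
-- the Theorems namespace of this sub repeats the summit name by design (D-0017 nested layout)
set_option linter.dupNamespace false

noncomputable section

open scoped NumberField
open Field
open Literature.NumberTheory.GaloisRepresentations
open Literature.NumberTheory.EllipticCurves
open Literature.NumberTheory.ComplexMultiplication.EllipticUnits
open Literature.NumberTheory.ComplexMultiplication.EllipticUnits.JohnsonLeungKings2011

namespace Summit.BirchSwinnertonDyer.BirchSwinnertonDyer.Theorems.SmallImageRttD2Twist

variable {K : Type} [Field K] [NumberField K] {p : ℕ} [Fact p.Prime] (S : Set (PadicAlgCl p))
  (κ₁ κ₂ : ZpExtension K p) (θ θ' : absoluteGaloisGroup K →ₜ* (padicCoeffIntegers S)ˣ)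

/-- **For `v ∈ 𝒪`, `‖v^{pⁿ} − 1‖ < 1` implies `‖v − 1‖ < 1`**: `(v − 1)^{pⁿ} = (v^{pⁿ} − 1) − p(v − 1)r` with `r ∈ 𝒪` (the binomial theorem mod `p`,
Mathlib `exists_add_pow_prime_pow_eq`), and the norm is ultrametric. [cite: SerreLocalFields1979, XIV §4] -/
theorem norm_sub_one_lt_of_norm_pow_sub_one_lt (v : padicCoeffIntegers S) (n : ℕ)
    (hv : ‖(v : PadicAlgCl p) ^ p ^ n - 1‖ < 1) : ‖(v : PadicAlgCl p) - 1‖ < 1 := by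
  obtain ⟨r, hr⟩ := exists_add_pow_prime_pow_eq (Fact.out : p.Prime) (v - 1) (1 : padicCoeffIntegers S) n
  rw [sub_add_cancel, one_pow, mul_one] at hr
  -- `(v − 1)^{pⁿ} = (v^{pⁿ} − 1) − p (v − 1) r`, read in `ℚ̄_p`
  have h := congrArg (fun x : padicCoeffIntegers S ↦ (x : PadicAlgCl p)) hr
  push_cast at h
  have hid : ((v : PadicAlgCl p) - 1) ^ p ^ n =
      ((v : PadicAlgCl p) ^ p ^ n - 1) + -(((p : ℕ) : PadicAlgCl p) * ((v : PadicAlgCl p) - 1) * (r : PadicAlgCl p)) := by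
    linear_combination (-1 : PadicAlgCl p) * h
  have h1 : ‖(v : PadicAlgCl p) - 1‖ ≤ 1 := by
    have h1' := (v - 1).2.2
    push_cast at h1'
    exact h1'
  have hpow : ‖(v : PadicAlgCl p) - 1‖ ^ p ^ n < 1 := by
    rw [← norm_pow, hid]
    refine (IsUltrametricDist.norm_add_le_max _ _).trans_lt (max_lt hv ?_)
    rw [norm_neg, norm_mul, norm_mul]
    calc ‖((p : ℕ) : PadicAlgCl p)‖ * ‖(v : PadicAlgCl p) - 1‖ * ‖(r : PadicAlgCl p)‖
        ≤ ‖((p : ℕ) : PadicAlgCl p)‖ * 1 * 1 := by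
          gcongr
          exact r.2.2
      _ < 1 := by rw [mul_one, mul_one]; exact norm_natCast_padicAlgCl_lt_one
  exact (pow_lt_one_iff_of_nonneg (norm_nonneg _) (pow_ne_zero n (Fact.out : p.Prime).ne_zero)).mp hpow

/-- ★★ **The twist parameters are principal units**: if `θ' = θ` on `Gal(K̄/K̃_∞)` then `‖θ(γ)θ'(γ)⁻¹ − 1‖ < 1` for EVERY `γ ∈ Γ_K` (`γ^{p^m} ∈ Gal(K̄/K̃_m)`, where
`θ ≡ θ' (mod p)` for `m` large by `exists_thresholds`; then `norm_sub_one_lt_of_norm_pow_sub_one_lt`). These are the hypotheses `h₁ h₂` of the LEAD's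
`exists_twistRingEquiv`/`exists_twistSkeleton` at `γ = γ₁, γ₂`. [cite: SerreLocalFields1979, XIV §4] [cite: JohnsonLeungKings2011, §4.1 (arXiv p0012:L7–14)] -/
theorem norm_twistUnit_sub_one_lt (hker : ∀ σ ∈ ZpExtension.pairKer κ₁ κ₂, θ' σ = θ σ) (γ : absoluteGaloisGroup K) :
    ‖((((θ γ * (θ' γ)⁻¹ : (padicCoeffIntegers S)ˣ)) : padicCoeffIntegers S) : PadicAlgCl p) - 1‖ < 1 := by
  -- thresholds for the pair (θ', θ): `θ σ = θ' σ + p^k b` on deep layers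
  obtain ⟨m, -, hm⟩ := exists_thresholds S κ₁ κ₂ θ' θ (fun σ hσ ↦ (hker σ hσ).symm)
  obtain ⟨b, hb⟩ := hm 1 (γ ^ p ^ m 1) (pow_mem_pairLayerSubgroup κ₁ κ₂ γ (m 1))
  rw [pow_one] at hb
  apply norm_sub_one_lt_of_norm_pow_sub_one_lt S _ (m 1)
  -- `(θ γ θ' γ⁻¹)^{p^m} = θ(γ^{p^m}) θ'(γ^{p^m})⁻¹ = 1 + p b θ'(γ^{p^m})⁻¹`
  have hu : ((θ γ * (θ' γ)⁻¹ : (padicCoeffIntegers S)ˣ)) ^ p ^ m 1 = θ (γ ^ p ^ m 1) * (θ' (γ ^ p ^ m 1))⁻¹ := by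
    rw [mul_pow, ← map_pow, inv_pow, ← map_pow]
  have hval : (((θ γ * (θ' γ)⁻¹ : (padicCoeffIntegers S)ˣ) : padicCoeffIntegers S)) ^ p ^ m 1 - 1 =
      ((p : padicCoeffIntegers S)) * (b * (((θ' (γ ^ p ^ m 1))⁻¹ : (padicCoeffIntegers S)ˣ) : padicCoeffIntegers S)) := by
    rw [← Units.val_pow_eq_pow_val, hu, Units.val_mul, hb, add_mul, Units.mul_inv]
    ring
  have e : ((((θ γ * (θ' γ)⁻¹ : (padicCoeffIntegers S)ˣ)) : padicCoeffIntegers S) : PadicAlgCl p) ^ p ^ m 1 - 1 =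
      ((((p : padicCoeffIntegers S)) * (b * (((θ' (γ ^ p ^ m 1))⁻¹ : (padicCoeffIntegers S)ˣ) : padicCoeffIntegers S)) :
        padicCoeffIntegers S) : PadicAlgCl p) := by
    rw [← hval]
    push_cast
    ring
  rw [e, Subring.coe_mul, norm_mul]
  calc ‖(((p : padicCoeffIntegers S)) : PadicAlgCl p)‖ *
        ‖((b * (((θ' (γ ^ p ^ m 1))⁻¹ : (padicCoeffIntegers S)ˣ) : padicCoeffIntegers S) : padicCoeffIntegers S) : PadicAlgCl p)‖
      ≤ ‖(((p : padicCoeffIntegers S)) : PadicAlgCl p)‖ * 1 := by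
        gcongr
        exact (b * (((θ' (γ ^ p ^ m 1))⁻¹ : (padicCoeffIntegers S)ˣ) : padicCoeffIntegers S)).2.2
    _ < 1 := by
        rw [mul_one]
        exact_mod_cast norm_natCast_padicAlgCl_lt_one (p := p)

end Summit.BirchSwinnertonDyer.BirchSwinnertonDyer.Theorems.SmallImageRttD2Twist

end
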